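import Mathlib
import Summits.MatrixMultiplication.MatrixMultiplication.Theses.LevelGradedCohnUmans
import Literature.NumberTheory.DiophantineGeometry.PartitionTableauxProofs
import Literature.NumberTheory.DiophantineGeometry.FirstRowPeeling
import Literature.RepresentationTheory.FiniteGroups.VershikKerovMaxDegreeProofs
import Literature.RepresentationTheory.FiniteGroups.VershikKerovLimitShape

/-!
# `SnLevelDesigns` (stmt-MatrixMultiplication-7613), line `garnir-annihilator`: S5h `stub_firstRowHooks` — first-row hook peeling

Crux `Summit.MatrixMultiplication.MatrixMultiplication.Theses.LevelGradedCohnUmans.SnLevelDesigns`; skeleton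
`Cruxes/SnLevelDesigns/Lines/garnir-annihilator.lean` (lead reshape, 7 registered stubs); this file proves the registered stub
`stub_firstRowHooks` verbatim (name + signature, tree-only vocabulary) and lands `--supports stmt-MatrixMultiplication-7613`.

(a) `f^μ ≤ C(n,j) · D(j)` with `j = n - μ₁`, `D(j) = maxCharDegree 𝔖_j = max_ν f^ν`
(`maxCharDegree_perm_eq`, `numStandardTableaux_le_maxCharDegree`): write `μ = (μ₁, ν)`, `ν ⊢ j`; by the hook
length formula (`numStandardTableaux_mul_prod_hookLength_holds`, PROVED in the tree) `f^μ = n!/∏h`, the hooks in rows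
`≥ 1` are those of `ν` and `h(0,c) = (μ₁ - c) + ν'_c ≥ μ₁ - c`, so `∏ h ≥ μ₁! · j!/f^ν`.
(b) for `3k ≤ n`: the shapes `(n-k, ν)`, `ν ⊢ k`, are pairwise distinct with largest part `n-k`, and
`∏_c h(0,c) = ∏_c ((n-k-c) + ν'_c) ≤ (n-k)! ∏_{c<k} e^{ν'_c/(k+1)} ≤ e · (n-k)!` (as `n-k-c ≥ k+1` for `c < k`), so
`f^{(n-k,ν)} ≥ C(n,k) f^ν / e`; summing squares with `Σ_{ν ⊢ k} (f^ν)² = k!` (`sum_sq_numStandardTableaux`) gives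
`D_k(n) = Σ_{μ₁ ≥ n-k} (f^μ)² ≥ e^{-2} C(n,k)² k!`.
The shape surgery (hooks of `(a, ν)` versus `ν`, the two inequalities) is the Literature file
`Literature/NumberTheory/DiophantineGeometry/FirstRowPeeling.lean` (landed first, `[folklore]`/FRT Theorem 1).
-/

set_option linter.dupNamespace false

namespace Summit.MatrixMultiplication.MatrixMultiplication.Theorems.SnLevelDesigns

open scoped BigOperators
open Literature.NumberTheory.DiophantineGeometry
open Literature.RepresentationTheory.FiniteGroups

/-- Part (a) of `stub_firstRowHooks`: **`f^μ ≤ C(n, n - μ₁) · D(n - μ₁)`** for every `μ ⊢ n`,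
`μ₁ = μ.parts.sup`, `D(j) = maxCharDegree 𝔖_j`: peel the first row (`μ = (μ₁, ν)`,
`numStandardTableaux_le_choose_mul`) and bound `f^ν ≤ D(n - μ₁)`
(`numStandardTableaux_le_maxCharDegree`); the empty partition (`n = 0`) is read off directly. -/
theorem frh_numStandardTableaux_le_choose_mul_maxCharDegree (n : ℕ) (μ : Nat.Partition n) :
    numStandardTableaux μ ≤ n.choose (n - μ.parts.sup) *
      maxCharDegree (Equiv.Perm (Fin (n - μ.parts.sup))) := by
  by_cases hn : n = 0
  · subst hn
    rw [Nat.zero_sub, Nat.choose_zero_right, one_mul]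
    exact numStandardTableaux_le_maxCharDegree μ
  · obtain ⟨ν, hs⟩ := exists_sortedParts_eq_sup_cons μ hn
    exact (numStandardTableaux_le_choose_mul hs).trans
      (Nat.mul_le_mul_left _ (numStandardTableaux_le_maxCharDegree ν))

/-- The level-`k` dimension count is at least `1` when `k = n = 0` (the empty shape contributes
`(f^∅)² = 1`). -/
theorem frh_one_le_sum_zero :
    (1 : ℝ) ≤ ((∑ μ : Nat.Partition 0, if 0 - 0 ≤ μ.parts.sup then
      numStandardTableaux μ ^ 2 else 0 : ℕ) : ℝ) := by
  have h1 : 1 ≤ ∑ μ : Nat.Partition 0, (if 0 - 0 ≤ μ.parts.sup then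
      numStandardTableaux μ ^ 2 else 0) :=
    calc 1 ≤ (if 0 - 0 ≤ (default : Nat.Partition 0).parts.sup then
          numStandardTableaux (default : Nat.Partition 0) ^ 2 else 0) := by
          rw [if_pos (Nat.zero_le _)]
          exact Nat.one_le_pow _ _ (numStandardTableaux_pos_holds _)
      _ ≤ _ := Finset.single_le_sum (f := fun μ : Nat.Partition 0 =>
          if 0 - 0 ≤ μ.parts.sup then numStandardTableaux μ ^ 2 else 0)
          (fun _ _ => Nat.zero_le _) (Finset.mem_univ _)
  exact_mod_cast h1

/-- Part (b) of `stub_firstRowHooks`: **`e^{-2} C(n,k)² k! ≤ D_k(n) = ∑_{μ₁ ≥ n-k} (f^μ)²`** for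
`3k ≤ n`: the shapes `(n - k, ν)`, `ν ⊢ k`, are pairwise distinct, have largest part `n - k`, and
satisfy `C(n,k) f^ν ≤ e · f^{(n-k,ν)}` (`choose_mul_numStandardTableaux_le_exp_mul`, as
`n - k ≥ 2k`); sum the squares and use `∑_{ν ⊢ k} (f^ν)² = k!` (`sum_sq_numStandardTableaux`). -/
theorem frh_exp_mul_choose_sq_mul_factorial_le_sum (n k : ℕ) (hk : 3 * k ≤ n) :
    Real.exp (-2) * ((n.choose k : ℝ) ^ 2 * (k.factorial : ℝ)) ≤
      ((∑ μ : Nat.Partition n, if n - k ≤ μ.parts.sup then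
        numStandardTableaux μ ^ 2 else 0 : ℕ) : ℝ) := by
  rcases Nat.eq_zero_or_pos (n - k) with h0 | hpos
  · have hn : n = 0 := by omega
    have hk0 : k = 0 := by omega
    subst hn
    subst hk0
    calc Real.exp (-2) * ((Nat.choose 0 0 : ℝ) ^ 2 * (Nat.factorial 0 : ℝ)) = Real.exp (-2) := by
          simp
      _ ≤ 1 := Real.exp_le_one_iff.2 (by norm_num)
      _ ≤ _ := frh_one_le_sum_zero
  · -- the shapes `(a, ν)`, `a = n - k`, `ν ⊢ k`
    set a := n - k with ha
    have hka : k ≤ a := by omega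
    have h2 : 2 * k ≤ a := by omega
    have han : a + k = n := by omega
    set Φ : Nat.Partition k → Nat.Partition n := fun ν =>
      ⟨a ::ₘ ν.parts, fun {i} hi => by
        rcases Multiset.mem_cons.1 hi with rfl | hi
        · exact hpos
        · exact ν.parts_pos hi, by rw [Multiset.sum_cons, ν.parts_sum, han]⟩ with hΦ
    have hΦparts : ∀ ν, (Φ ν).parts = a ::ₘ ν.parts := fun ν => rfl
    have hle : ∀ (ν : Nat.Partition k), ∀ b ∈ ν.parts, b ≤ a := fun ν b hb =>
      (Nat.Partition.le_of_mem_parts hb).trans hka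
    have hΦinj : Function.Injective Φ := fun ν₁ ν₂ h =>
      Nat.Partition.ext ((Multiset.cons_inj_right a).1 (by rw [← hΦparts, ← hΦparts, h]))
    have hΦsup : ∀ ν, (Φ ν).parts.sup = a := fun ν =>
      sup_parts_eq_of_parts_eq_cons (Φ ν) ν (hΦparts ν) (hle ν)
    have hΦs : ∀ ν, (Φ ν).sortedParts = a :: ν.sortedParts := fun ν =>
      sortedParts_eq_cons (Φ ν) ν (hΦparts ν) (hle ν)
    have hΦf : ∀ ν, (n.choose k : ℝ) * numStandardTableaux ν ≤
        Real.exp 1 * numStandardTableaux (Φ ν) := fun ν =>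
      choose_mul_numStandardTableaux_le_exp_mul (hΦs ν) h2
    -- the sum over the image of `Φ`
    have hsub : ∑ ν : Nat.Partition k, numStandardTableaux (Φ ν) ^ 2 ≤
        ∑ μ : Nat.Partition n, (if a ≤ μ.parts.sup then numStandardTableaux μ ^ 2 else 0) := by
      calc ∑ ν : Nat.Partition k, numStandardTableaux (Φ ν) ^ 2
          = ∑ μ ∈ Finset.univ.image Φ,
              (if a ≤ μ.parts.sup then numStandardTableaux μ ^ 2 else 0) := by
            rw [Finset.sum_image fun ν₁ _ ν₂ _ h => hΦinj h]
            refine Finset.sum_congr rfl fun ν _ => ?_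
            rw [if_pos (hΦsup ν).ge]
        _ ≤ _ := Finset.sum_le_sum_of_subset (Finset.subset_univ _)
    -- termwise
    have hterm : ∀ ν : Nat.Partition k,
        Real.exp (-2) * ((n.choose k : ℝ) * numStandardTableaux ν) ^ 2 ≤
          (numStandardTableaux (Φ ν) : ℝ) ^ 2 := by
      intro ν
      have h0 : 0 ≤ (n.choose k : ℝ) * numStandardTableaux ν := by positivity
      have h1 : ((n.choose k : ℝ) * numStandardTableaux ν) ^ 2 ≤
          (Real.exp 1 * numStandardTableaux (Φ ν)) ^ 2 := pow_le_pow_left₀ h0 (hΦf ν) 2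
      calc Real.exp (-2) * ((n.choose k : ℝ) * numStandardTableaux ν) ^ 2
          ≤ Real.exp (-2) * (Real.exp 1 * numStandardTableaux (Φ ν)) ^ 2 :=
            mul_le_mul_of_nonneg_left h1 (Real.exp_pos _).le
        _ = (Real.exp (-2) * (Real.exp 1 * Real.exp 1)) * (numStandardTableaux (Φ ν) : ℝ) ^ 2 := by
            ring
        _ = (numStandardTableaux (Φ ν) : ℝ) ^ 2 := by
            rw [← Real.exp_add, ← Real.exp_add]
            norm_num
    calc Real.exp (-2) * ((n.choose k : ℝ) ^ 2 * (k.factorial : ℝ))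
        = Real.exp (-2) * ((n.choose k : ℝ) ^ 2 *
            ∑ ν : Nat.Partition k, ((numStandardTableaux ν : ℕ) : ℝ) ^ 2) := by
          rw [← sum_sq_numStandardTableaux k]
          push_cast
          rfl
      _ = ∑ ν : Nat.Partition k,
            Real.exp (-2) * ((n.choose k : ℝ) * numStandardTableaux ν) ^ 2 := by
          rw [Finset.mul_sum, Finset.mul_sum]
          exact Finset.sum_congr rfl fun ν _ => by ring
      _ ≤ ∑ ν : Nat.Partition k, (numStandardTableaux (Φ ν) : ℝ) ^ 2 :=
          Finset.sum_le_sum fun ν _ => hterm ν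
      _ = ((∑ ν : Nat.Partition k, numStandardTableaux (Φ ν) ^ 2 : ℕ) : ℝ) := by push_cast; rfl
      _ ≤ _ := by exact_mod_cast hsub

/-- **`stub_firstRowHooks`** (registered stub of crux stmt-MatrixMultiplication-7613, line `garnir-annihilator`).
(a) `f^μ ≤ C(n,j) · D(j)` with `j = n - μ₁`, `D(j) = maxCharDegree 𝔖_j = max_ν f^ν`
(`frh_numStandardTableaux_le_choose_mul_maxCharDegree`); (b) for `3k ≤ n`,
`e^{-2} C(n,k)² k! ≤ D_k(n) = ∑_{μ₁ ≥ n-k} (f^μ)²` (`frh_exp_mul_choose_sq_mul_factorial_le_sum`).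
Both by peeling the first row of the shape (`Literature/NumberTheory/DiophantineGeometry/FirstRowPeeling.lean`:
hook length formula, `h(0,s) = (μ₁ - s) + ν'_s`). -/
theorem stub_firstRowHooks :
    (∀ (n : ℕ) (μ : Nat.Partition n),
        Literature.NumberTheory.DiophantineGeometry.numStandardTableaux μ ≤ n.choose (n - μ.parts.sup) *
          Literature.RepresentationTheory.FiniteGroups.maxCharDegree (Equiv.Perm (Fin (n - μ.parts.sup)))) ∧
      (∀ (n k : ℕ), 3 * k ≤ n →
        Real.exp (-2) * ((n.choose k : ℝ) ^ 2 * (k.factorial : ℝ)) ≤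
          ((∑ μ : Nat.Partition n, if n - k ≤ μ.parts.sup then
              Literature.NumberTheory.DiophantineGeometry.numStandardTableaux μ ^ 2 else 0 : ℕ) : ℝ)) :=
  ⟨frh_numStandardTableaux_le_choose_mul_maxCharDegree, frh_exp_mul_choose_sq_mul_factorial_le_sum⟩

end Summit.MatrixMultiplication.MatrixMultiplication.Theorems.SnLevelDesigns
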